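import Summits.HodgeConjecture.HodgeConjecture.Theorems.Ring2AbelianAllAndreJunction
import Summits.HodgeConjecture.HodgeConjecture.Theorems.Ring2HypothesesDescentHolds
import Literature.AlgebraicGeometry.HodgeTheory.LefschetzStandardOfHodgeConjectureSquare
import HarnessLib

/-!
# Ring 2 · sub-cell AbelianAll (ALL ABELIAN VARIETIES), André axis — ab-andre-1 part VI: the Lefschetz nodes
# (5∀), (5) are CASES OF THE SUMMIT with NO named fact

HONEST FRAMING (page 1, verbatim): **research route, not a corollary; conditional on HC_CM plus one named
minimal statement.** Cell line: research route conditional on HC_CM; not a corollary; Q11.4-sentence-2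
already refuted in dim ≥ 3. Nothing in this file proves an open case of the Hodge conjecture. `HC_CM` =
`Theses.RankFourFaces.CMAbelianHodge` (a BINDER, never cited as a fact), `HC_AV` =
`Theses.PadicSemiregularLift.HodgeAbelianVarieties`; the item `Theses.RankFourFaces.CMToAbelian`
(stmt-HodgeConjecture-16267) is OPEN and not closed here. Seat `pub-hodge-ring2-ab-andre-1`, gen 4.

## What changed since parts I–V

The binder `hK : Kleiman1968_lefschetzInvolution_algebraic_of_hodgeClasses_prod` ("`HC(X × X) ⇒ B(X)`") of the
on-path lemmas of part I (`compactAbelianPencilLefschetz_of_hodgeConjecture`) and of andre-2's part II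
(`lefschetzBCompactPencils_of_hodgeConjecture`) is now a THEOREM of the tree:
`Kleiman1968_lefschetzInvolution_algebraic_of_hodgeClasses_prod_holds` (Voisin I Lemma 11.41 in every bidegree,
`LefschetzStandardOfHodgeConjectureSquare`); likewise André's span fact `hMH` is
`Andre1996_motivatedClasses_le_span_hodgeClasses_holds`. This file feeds both.

## Content

* §A ON-PATH, FACT-FREE: `HodgeConjecture ⟹ (5∀) ⟹ (5)` on both seats' spellings
  (`compactAbelianPencilLefschetz_of_hodgeConjecture_holds`, `lefschetzBCompactPencils_of_hodgeConjecture_holds`, …):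
  after andre-2's part VI (`liftLadder_of_hodgeConjecture`) the Lefschetz nodes were the only André-axis nodes whose
  on-path still displayed a named fact; now EVERY node of the axis is a case of the summit in the kernel
  (`andreAxisNodes_of_hodgeConjecture_holds`). The precise cost of `B` on one pencil total space is recorded:
  `HodgeConjectureFor (2d+2) (𝒳 × 𝒳)` (`standardConjectureBStar_total_of_hodgeConjectureFor_sq`).
* §B the `hMH`-free rows of part I §E (`…_holds`): `B_pen ⟹ MotivatedImpliesAlgebraicAV` and the four-node
  conjunction now display only `h₈` (Abdulali pp. 1122–1123) and `h₂₁`, `h₂₂` (Lemmes 6.3.1–6.3.3).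
* The GRADED Lefschetz nodes `(5∀)_d`, `(5)_d` and the graded row `HC_CM ∧ (5)_{2g} ⟹ HCAtDim g` are the companion
  file `Ring2AbelianAllLefschetzPencilsGraded`.

NOT CLAIMED: `HC_AV ⟹ (5)` / `(5∀)` (reported in print, Tankeev 2008, text unobtainable: acq-01874 / acq-08448);
minimality of any node; any discharge of `h₈`.

References: Andre1996Motifs (§6.3, Lemme 6.3.1, Remarque 2 p. 33); Abdulali1994FamiliesAV (pp. 1122–1123, Lemma
6.2); Milne2020HodgeClassesAV (Thm. 4, Prop. 1, Rem. 3); Voisin2025 (§3.2.2 (15)–(16), Lemma 2.9);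
Kleiman1968AlgebraicCycles (§2); VoisinHodgeI2002 (Lemma 11.41). No `sorry`, no new axiom, no new definition;
every theorem is a short instantiation.
-/
noncomputable section

-- The summit's namespace repeats `HodgeConjecture` (summit = sub-problem); every file of the axis disables this linter.
set_option linter.dupNamespace false

namespace Summit.HodgeConjecture.HodgeConjecture.Ring2.AbelianAll

open CategoryTheory AlgebraicGeometry MonoidalCategory
open Literature.AlgebraicGeometry Literature.AlgebraicGeometry.Motives
open Literature.AlgebraicGeometry.HodgeTheory
open Literature.AlgebraicGeometry.Abdulali1994 (InvariantCyclesHoldFor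
  Abdulali1994_invariantCycles_of_lefschetzStandard)
open Literature.AlgebraicGeometry.Andre1996 (andre1996_cmAnchoredPencil
  andre1996_cmHodgeClasses_algebraicallyAnchoredPencils)
open Summit.HodgeConjecture.HodgeConjecture
open Summit.HodgeConjecture.HodgeConjecture.Theses
open Summit.HodgeConjecture.HodgeConjecture.Ring2.Deform (CompactAbelianPencilVHC)
open Summit.HodgeConjecture.HodgeConjecture.Ring2.Hypotheses (MotivatedImpliesAlgebraicAV
  motivatedImpliesAlgebraicAV_of_hc_av_holds)

/-! ## §A ON-PATH, fact-free: the Lefschetz nodes are cases of the summit -/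

/-- **The cost of `B` on ONE pencil total space, exactly**: for a compact pencil of abelian `d`-folds `f : 𝒳 ⟶ S`,
the Hodge conjecture for the `(2d+2)`-fold `𝒳 × 𝒳` gives `B*(𝒳)` for every `η` — the Kleiman–Voisin theorem of the
tree (`standardConjectureBStar_of_hodgeConjectureFor_prod`) at the smooth projective `(d+1)`-fold `𝒳`.
[cite: Voisin2025, §3.2.2 (15)–(16) and Lemma 2.9] [cite: Kleiman1968AlgebraicCycles, §2] -/
theorem standardConjectureBStar_total_of_hodgeConjectureFor_sq {d : ℕ} {𝒳 S : SchemeOver ℂ} {f : 𝒳 ⟶ S}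
    (hf : IsCompactAbelianPencil f d) (h : HodgeConjectureFor ((d + 1) + (d + 1)) (𝒳 ⊗ 𝒳))
    (η : complexBetti 𝒳 2) : StandardConjectureBStar (d + 1) 𝒳 η :=
  standardConjectureBStar_of_hodgeConjectureFor_prod hf.isSmoothProjective_total h η

/-- **ON-PATH, FACT-FREE: `HodgeConjecture ⟹ B_pen` (5∀)** (andre-1 spelling). Part I's
`compactAbelianPencilLefschetz_of_hodgeConjecture` fed with the tree theorem
`Kleiman1968_lefschetzInvolution_algebraic_of_hodgeClasses_prod_holds`: no binder left.
[cite: Voisin2025, §3.2.2 (15)–(16) and Lemma 2.9] [cite: Andre1996Motifs, §6.3 Remarque 2 (p. 33)] -/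
theorem compactAbelianPencilLefschetz_of_hodgeConjecture_holds (h : _root_.HodgeConjecture) :
    CompactAbelianPencilLefschetz :=
  compactAbelianPencilLefschetz_of_hodgeConjecture Kleiman1968_lefschetzInvolution_algebraic_of_hodgeClasses_prod_holds h

/-- **ON-PATH, FACT-FREE: `HodgeConjecture ⟹ B_pen^CM` (5)** (andre-1 spelling). [cite: Voisin2025, §3.2.2] -/
theorem cmPointedPencilLefschetz_of_hodgeConjecture_holds (h : _root_.HodgeConjecture) : CMPointedPencilLefschetz :=
  cmPointedPencilLefschetz_of_hodgeConjecture Kleiman1968_lefschetzInvolution_algebraic_of_hodgeClasses_prod_holds h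

/-- **ON-PATH, FACT-FREE: `HodgeConjecture ⟹ (5∀)`** on andre-2's spelling `LefschetzBCompactPencils`.
[cite: Voisin2025, §3.2.2 (15)–(16) and Lemma 2.9] -/
theorem lefschetzBCompactPencils_of_hodgeConjecture_holds (h : _root_.HodgeConjecture) : LefschetzBCompactPencils :=
  lefschetzBCompactPencils_of_hodgeConjecture Kleiman1968_lefschetzInvolution_algebraic_of_hodgeClasses_prod_holds h

/-- **ON-PATH, FACT-FREE: `HodgeConjecture ⟹ (5)`** on andre-2's spelling `LefschetzBCMPointedPencils`.
[cite: Voisin2025, §3.2.2] -/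
theorem lefschetzBCMPointedPencils_of_hodgeConjecture_holds (h : _root_.HodgeConjecture) :
    LefschetzBCMPointedPencils :=
  lefschetzBCMPointedPencils_of_lefschetzBCompactPencils (lefschetzBCompactPencils_of_hodgeConjecture_holds h)

/-- **Part I's on-path summary, now fact-free**: `HodgeConjecture ⟹ B_pen ∧ B_pen^CM ∧ T_CM^→`. [folklore] -/
theorem nodes_of_hodgeConjecture_holds (h : _root_.HodgeConjecture) :
    CompactAbelianPencilLefschetz ∧ CMPointedPencilLefschetz ∧ CMFibreTransport :=
  nodes_of_hodgeConjecture Kleiman1968_lefschetzInvolution_algebraic_of_hodgeClasses_prod_holds h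

/-- **EVERY NODE OF THE ANDRÉ AXIS IS A CASE OF THE SUMMIT, in the kernel, with no named fact**: the Lefschetz
nodes (5∀), (5) (this file), the transport nodes (3) = `CompactAbelianPencilVHC`, (4) = `CMAnchoredTransport`
(andre-2 part I, from `HC_AV`), and the target `HC_AV` itself. (The lift nodes (L∀), (L) and the fibre-class nodes
are andre-2's `liftLadder_of_hodgeConjecture`, not repeated.) [folklore] -/
theorem andreAxisNodes_of_hodgeConjecture_holds (h : _root_.HodgeConjecture) :
    LefschetzBCompactPencils ∧ LefschetzBCMPointedPencils ∧ CompactAbelianPencilVHC ∧ CMAnchoredTransport ∧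
      PadicSemiregularLift.HodgeAbelianVarieties :=
  ⟨lefschetzBCompactPencils_of_hodgeConjecture_holds h, lefschetzBCMPointedPencils_of_hodgeConjecture_holds h,
    Deform.compactAbelianPencilVHC_of_HC_AV (Deform.HC_AV_of_hodgeConjecture h),
    cmAnchoredTransport_iff_cmFibreTransport.2 (cmFibreTransport_of_hodgeConjecture h),
    Deform.HC_AV_of_hodgeConjecture h⟩

/-! ## §B Part I §E without the span fact `hMH` -/

/-- **`B_pen ⟹ MotivatedImpliesAlgebraicAV`** granted `h₈` (Abdulali pp. 1122–1123) and Lemmes 6.3.1–6.3.3 only: part I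
§E with André's span fact fed by the tree theorem `Andre1996_motivatedClasses_le_span_hodgeClasses_holds`.
[cite: Andre1996Motifs, §2.5 c) (p. 18), §6.2 (p. 31) and Remarque 2 (p. 33)] [cite: Abdulali1994FamiliesAV, pp. 1122–1123] -/
theorem motivatedImpliesAlgebraicAV_of_abdulali_of_andre1996_of_compactAbelianPencilLefschetz_holds
    (h₈ : Abdulali1994_invariantCycles_of_lefschetzStandard) (h₂₁ : andre1996_cmAnchoredPencil)
    (h₂₂ : andre1996_cmHodgeClasses_algebraicallyAnchoredPencils) (hB : CompactAbelianPencilLefschetz) :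
    MotivatedImpliesAlgebraicAV :=
  motivatedImpliesAlgebraicAV_of_hc_av_holds
    (HC_AV_of_abdulali_of_andre1996_of_compactAbelianPencilLefschetz h₈ h₂₁ h₂₂ hB)

/-- **The four flavours lined up, `hMH`-free**: `B_pen ⟹ CompactAbelianPencilVHC ∧ MotivatedImpliesAlgebraicAV ∧ HC_AV ∧
HC_CM` granted `h₈`, `h₂₁`, `h₂₂`. [cite: Andre1996Motifs, Remarque 2 (p. 33)] [cite: Milne2020HodgeClassesAV, Thm. 4 and Rem. 3] -/
theorem andreAxis_of_abdulali_of_andre1996_of_compactAbelianPencilLefschetz_holds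
    (h₈ : Abdulali1994_invariantCycles_of_lefschetzStandard) (h₂₁ : andre1996_cmAnchoredPencil)
    (h₂₂ : andre1996_cmHodgeClasses_algebraicallyAnchoredPencils) (hB : CompactAbelianPencilLefschetz) :
    CompactAbelianPencilVHC ∧ MotivatedImpliesAlgebraicAV ∧ PadicSemiregularLift.HodgeAbelianVarieties ∧
      RankFourFaces.CMAbelianHodge :=
  andreAxis_of_abdulali_of_andre1996_of_compactAbelianPencilLefschetz h₈ h₂₁ h₂₂
    Andre1996_motivatedClasses_le_span_hodgeClasses_holds hB

end Summit.HodgeConjecture.HodgeConjecture.Ring2.AbelianAll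

end
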